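import Mathlib.Topology.UniformSpace.HeineCantor
import Mathlib.Order.Filter.Finite
import Summits.AtomisticToContinuum.HydrodynamicLimit.Theorems.CollisionIsometryCLTHsFreeEnergyConvexBasic
import HarnessLib

/-!
# A Dini/Pólya-type uniformity lemma on a compact interval (stub `tl_dini`)

Support file (`--supports stmt-AtomisticToContinuum-14870`) of the lead of the line `IdeatorTwoGen1Sketch`
for the crux `MacroClosure`, wave 4 (existence of the thermodynamic limit of the hard-sphere free
energy): the elementary real-analysis step that upgrades pointwise eventual lower bounds to uniform ones.

If the functions `g n : ℝ → ℝ` are eventually (in `n`) nondecreasing on `[a, c]`, `F` is continuous on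
`[a, c]`, and at every point `x ∈ [a, c]` the one-sided bound `F x - ε ≤ g n x` holds eventually for
every `ε > 0`, then for every `ε > 0` the bound `F x - ε ≤ g n x` holds eventually *uniformly* in
`x ∈ [a, c]`.

Proof: `F` is uniformly continuous on the compact interval (Heine–Cantor); choose `δ > 0` with
`|F x - F y| ≤ ε/2` for `|x - y| ≤ δ`, and the finite grid `a + i δ`, `i ≤ ⌊(c - a)/δ⌋₊`. Finitely many
eventual statements combine; for a good `n` and `x ∈ [a, c]` the grid point `xᵢ = a + ⌊(x - a)/δ⌋₊ δ`
satisfies `xᵢ ≤ x < xᵢ + δ`, whence `g n x ≥ g n xᵢ ≥ F xᵢ - ε/2 ≥ F x - ε`.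

Reference: G. Pólya, G. Szegő, *Problems and Theorems in Analysis I*, Part II, Problem 127 (Dini/Pólya
uniformity for monotone functions).
-/

namespace Summit.AtomisticToContinuum.HydrodynamicLimit.Theorems.MacroClosureLine

open MeasureTheory Filter Set Topology
open scoped ENNReal
open Literature.MathematicalPhysics.KineticTheory Literature.Analysis.FluidPDE Literature.Analysis.FunctionSpaces

namespace Barycentric

namespace TlDini

/-- The grid point below `x`: with `i = ⌊(x - a)/δ⌋₊` one has `a + i δ ≤ x` and `x - (a + i δ) < δ`. -/
theorem floor_grid {a x δ : ℝ} (hδ : 0 < δ) (hax : a ≤ x) :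
    a + (⌊(x - a) / δ⌋₊ : ℝ) * δ ≤ x ∧ x - (a + (⌊(x - a) / δ⌋₊ : ℝ) * δ) < δ := by
  have h0 : 0 ≤ (x - a) / δ := div_nonneg (sub_nonneg.2 hax) hδ.le
  have h1 : (⌊(x - a) / δ⌋₊ : ℝ) ≤ (x - a) / δ := Nat.floor_le h0
  have h2 : (x - a) / δ < ⌊(x - a) / δ⌋₊ + 1 := Nat.lt_floor_add_one _
  rw [le_div_iff₀ hδ] at h1
  rw [div_lt_iff₀ hδ] at h2
  constructor <;> linarith

/-- The grid points `a + i δ`, `i ≤ ⌊(c - a)/δ⌋₊`, lie in `[a, c]`. -/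
theorem grid_mem {a c δ : ℝ} (hδ : 0 < δ) (hac : a ≤ c) {i : ℕ} (hi : i ≤ ⌊(c - a) / δ⌋₊) :
    a ≤ a + (i : ℝ) * δ ∧ a + (i : ℝ) * δ ≤ c := by
  refine ⟨le_add_of_nonneg_right (by positivity), ?_⟩
  have hiK : (i : ℝ) ≤ ⌊(c - a) / δ⌋₊ := by exact_mod_cast hi
  have hKle : ((⌊(c - a) / δ⌋₊ : ℕ) : ℝ) ≤ (c - a) / δ :=
    Nat.floor_le (div_nonneg (sub_nonneg.2 hac) hδ.le)
  have : (i : ℝ) * δ ≤ c - a := by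
    rw [← le_div_iff₀ hδ]
    exact hiK.trans hKle
  linarith

end TlDini

/-- **Dini/Pólya uniformity.** Functions `g n` eventually nondecreasing on `[a, c]`, a continuous `F`
on `[a, c]`, and pointwise eventual one-sided bounds `F x - ε ≤ g n x` (`x ∈ [a, c]`, `ε > 0`) give the
one-sided bound uniformly in `x ∈ [a, c]`, eventually in `n`, for every `ε > 0`. -/
theorem tl_dini : ∀ (g : ℕ → ℝ → ℝ) (F : ℝ → ℝ) (a c : ℝ), a ≤ c → ContinuousOn F (Icc a c) →
    (∀ᶠ n in atTop, ∀ x y, a ≤ x → x ≤ y → y ≤ c → g n x ≤ g n y) →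
    (∀ x, a ≤ x → x ≤ c → ∀ ε, 0 < ε → ∀ᶠ n in atTop, F x - ε ≤ g n x) →
    ∀ ε, 0 < ε → ∀ᶠ n in atTop, ∀ x, a ≤ x → x ≤ c → F x - ε ≤ g n x := by
  intro g F a c hac hF hmono hpt ε hε
  -- uniform continuity of `F` on the compact interval
  have hUC : UniformContinuousOn F (Icc a c) := isCompact_Icc.uniformContinuousOn_of_continuous hF
  obtain ⟨δ, hδ, hδF⟩ := Metric.uniformContinuousOn_iff_le.1 hUC (ε / 2) (half_pos hε)
  -- the finite grid `a + i δ`, `i ≤ K`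
  set K : ℕ := ⌊(c - a) / δ⌋₊
  have hgrid : ∀ᶠ n in atTop, ∀ i ∈ Finset.range (K + 1),
      F (a + (i : ℝ) * δ) - ε / 2 ≤ g n (a + (i : ℝ) * δ) := by
    refine (Filter.eventually_all_finset _).2 fun i hi => ?_
    have hiK : i ≤ K := Nat.lt_succ_iff.1 (Finset.mem_range.1 hi)
    obtain ⟨h1, h2⟩ := TlDini.grid_mem hδ hac hiK
    exact hpt _ h1 h2 _ (half_pos hε)
  filter_upwards [hmono, hgrid] with n hmn hgn x hax hxc
  -- the grid point below `x`
  obtain ⟨hxi, hxd⟩ := TlDini.floor_grid hδ hax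
  set i : ℕ := ⌊(x - a) / δ⌋₊
  have hiK : i ≤ K := Nat.floor_mono (div_le_div_of_nonneg_right (by linarith) hδ.le)
  have himem : i ∈ Finset.range (K + 1) := Finset.mem_range.2 (Nat.lt_succ_iff.2 hiK)
  obtain ⟨haxi, hxic⟩ := TlDini.grid_mem hδ hac hiK
  have hdist : dist (a + (i : ℝ) * δ) x ≤ δ := by
    rw [Real.dist_eq, abs_sub_comm, abs_of_nonneg (by linarith)]
    exact hxd.le
  have hFd := hδF (a + (i : ℝ) * δ) ⟨haxi, hxic⟩ x ⟨hax, hxc⟩ hdist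
  rw [Real.dist_eq] at hFd
  have h1 := hgn i himem
  have h2 := hmn (a + (i : ℝ) * δ) x haxi hxi hxc
  have h3 : F x - F (a + (i : ℝ) * δ) ≤ ε / 2 := (abs_sub_le_iff.1 hFd).2
  linarith

end Barycentric

end Summit.AtomisticToContinuum.HydrodynamicLimit.Theorems.MacroClosureLine
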